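import Summits.HodgeConjecture.HodgeConjecture.Theses.EndoscopicMiddleDegree
import Summits.HodgeConjecture.HodgeConjecture.Theorems.EndoscopicMiddleDegreeOrthogonalEnvelopedCorrAlgebra
import Summits.HodgeConjecture.HodgeConjecture.Theorems.EndoscopicMiddleDegreeMiddleThetaSpanHeckeIdempotents
import Summits.HodgeConjecture.HodgeConjecture.Theorems.OrthogonalEnveloped.Negative.EnvelopeOfAlgebraic
import Literature.AlgebraicGeometry.ShimuraVarieties.HeckeCorrespondenceAction
import Literature.AlgebraicGeometry.HodgeTheory.CorrespondenceActionOfGraph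
import Literature.AlgebraicGeometry.HodgeTheory.HodgeTypeConjugation
import Literature.AlgebraicGeometry.Motives.AlgebraicClassesPotentiallyTate

/-!
# Line `hodge-tate-legible-envelope` for crux `EndoscopicMiddleDegree.OrthogonalEnveloped`
# (stmt-HodgeConjecture-14300) — LEAD's skeleton rev L1 (third lineage, seat c2, cycle 1, 2026-08-16):
# the planner's checked skeleton with `stub_rationalBlocks` replaced by the LANDED theorem (p87916, verbatim copy)

THE CRUX (rank 4, the automorphic heart of route `EndoscopicMiddleDegree`). For an orientation
family `μ` with Poincaré duality, `m ∈ {1,2}` (`n = m + 1`, `dim X = 2n`), a datum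
`D : UnitaryBallQuotientDatum (2n) X` and a RATIONAL class `e ∈ H²ⁿ(X(ℂ); ℂ)` of Hodge type
`(n,n)` cup-orthogonal to the theta world `TW(D)`, there is `γ ∈ algebraicClasses (X ⊗ X) (2n)` whose
action `P_γ β = pr₁₊(pr₂^* β ∪ γ)` — the tree's `corrAction μ hX hX rfl γ`, `rfl` — preserves
rational classes, has purely `(n,n)` image and fixes `e`.

THE LINE (idea card `Ideas/hodge-tate-legible-envelope.md`, ideator 2; triage r1-1/r1-2: pass).
An algebraic envelope is a MOTIVE, hence Hodge–Tate LEGIBLE: the Hodge types of the image of an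
algebraically cut, rationally defined piece of `H²ⁿ` are read off the Galois side. The envelope of
`e` is the sum `P := Σ_{ε e ≠ 0} ε` of the ℚ-BLOCKS of the Hecke algebra that MEET `e`
(`stub_rationalBlocks`, LANDED p87916; each block is the action of an algebraic class by the Hecke
infrastructure shared with line `impure-barren-envelope`: `stub_heckePushPull`, `stub_cupTriple`,
`stub_corrAlgebra` LANDED p91059, Literature `CorrespondenceActionOfGraph` LANDED p92131). `P` is
rational-preserving and fixes `e` TRIVIALLY (`Σ_all ε = 1` and the dead blocks kill `e` by
definition). ALL the content is the PURITY of the live blocks, and the line factors it through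
ℓ-adic Tate classes — typable in the tree through the accepted realization data
`E K ℓ : EtaleRealization K ℓ`, `B : BettiHodgeData ℂ`, `C K ℓ : ArtinComparison (E K ℓ) B K.subtype`
and `GaloisWeilCohomology.tateClasses` (Literature `Motives/HodgeClassesPotentiallyTate`, the
convention of route LosTransfer's crux `HodgeClassesPotentiallyTate`; every Tate clause below is
that file's clause verbatim, specialised to degree `2n`, and GUARDED by the tree's two hypothesis
predicates `AlgebraicClassesArePotentiallyTate E B C` and `B.IsSummitCompatible` — the audit of
`Motives/AlgebraicClassesPotentiallyTate` (2026-08-15) records that "algebraic ⟹ potentially Tate" is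
NOT derivable for unrelated realization data, so unguarded universal closures over `(E, B, C)` would
not be the printed theorems; with the guards, the bet is HC-implied IN LEAN, `tateOrthogonal_of_middleHC`):

* `stub_tateOrthogonal` — THE BET (= the card's Transfer `TateOrthogonal(m)`): a rational Hodge
  `(n,n)`-class `e ⊥ TW(D)` on the sector is POTENTIALLY TATE (for every realization datum, every
  finitely generated model `X₀/K`, every `ℓ`, its comparison image lies in `Tateⁿ(X₀)`). It is the
  sector-and-`⊥TW` restriction of `Motives.HodgeClassesArePotentiallyTate`
  (`tateOrthogonal_of_potentiallyTate`, PROVED), hence implied by LosTransfer's crux #4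
  (stmt-HodgeConjecture-2402) and by "Hodge ⟹ absolute Hodge"; and it is implied by HC in the middle
  degree of the sector (`tateOrthogonal_of_middleHC`, PROVED from the Literature theorem
  `AlgebraicClassesArePotentiallyTate.summit` — Disproof F1 for this stub, in Lean). HC-strength on
  the wide cores (there it IS CoreVanishing: a core carries no Tate line); FREE on Tate-type pieces.
* `stub_tateAllOrNothing` — GALOIS LEGIBILITY (paper THEOREM modulo R3 Kottwitz/Kisin–Shin–Zhu
  shape of `H²ⁿ_ét`, R4 Patrikis–Taylor irreducibility at ONE `ℓ`, R5 regularity, and the slot-purity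
  census of Disproof F5 = cards chi-zero-separation ≈ middle-involution-purity): a ℚ-block of the
  Hecke algebra that meets a rational potentially-Tate class consists ENTIRELY of potentially-Tate
  classes (a Tate line sits in a character constituent centred at every embedding — Clifford +
  two Hodge–Tate weights exclude `d ≥ 2` constituents — so the block is Tate type at every
  conjugate, hence pure, hence its `H²ⁿ_ℓ` is the middle character: all Tate).
* `stub_tatePure` — FALTINGS LEGIBILITY (paper THEOREM modulo R1 `C_HT`/`C_dR` and R2 its
  compatibility with cycle classes, cup products and Gysin maps; datum-free): the image of a
  rational-preserving ALGEBRAIC self-correspondence of `X` (dimension `2n`, degree `2n`) all of whose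
  rational values are potentially Tate is of pure type `(n,n)` (`Im P ⊗ ℚ_ℓ` is Galois-stable of
  the single Hodge–Tate weight `n`, so `P` kills `H^{p,q}`, `p ≠ n`).

`OrthogonalEnveloped_of : OrthogonalEnveloped` is the kernel-checked composition: it uses the six declared stubs BY
NAME and nothing else unproved (no `sorry` outside `stub_*`; the A12 audit `#h21_check_skeleton` requires this shape).

Disproof used (`Cruxes/OrthogonalEnveloped/Disproof.lean`, cycle 1; landed
`Theorems/OrthogonalEnveloped/Negative/EnvelopeOfAlgebraic` p80733, IMPORTED here): F1 — no kill
short of `¬HC`; all three Tate stubs are HC-implied (cycle classes are Tate). F4 — `IsRationalClass e`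
is used at `stub_tateOrthogonal`/`stub_tateAllOrNothing` (a Betti lift `t` is needed even to STATE
Tate-ness) and `IsOfHodgeType e` at `stub_tateOrthogonal` (Hodge ⟹ Tate); neither is dropped
(`withoutRational_false_of_…`, `withoutHodgeType_false_of_…` honoured). F3 — `μ` arbitrary, no
twist issue (`stub_tatePure` is stated for every `μ`). F5/F5b — the residue of the line on wide
cores is CoreVanishing, as for every line (F5: "a prover cannot avoid it"); F7 — `e ⊥ TW(D)` is
kept only inside the bet, where it makes the statement weaker.
-/

noncomputable section

-- The crux-workfile namespace `Summit.<P>.<Sub>.Cruxes.…` repeats `HodgeConjecture` (single-conjunct summit).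
set_option linter.dupNamespace false

namespace Summit.HodgeConjecture.HodgeConjecture.Cruxes.OrthogonalEnveloped.HodgeTateLegibleEnvelope

open scoped BigOperators TensorProduct
open CategoryTheory MonoidalCategory CartesianMonoidalCategory
open Literature.AlgebraicGeometry.Motives (SchemeOver ComplexPoints IsSmoothProjective EtaleRealization
  BettiHodgeData ArtinComparison artinComparisonEquiv baseChangeHom HodgeClassesArePotentiallyTate
  AlgebraicClassesArePotentiallyTate)
open Literature.AlgebraicGeometry.Motives (IsSmoothProjective.tensor_holds)
open Literature.AlgebraicGeometry.HodgeTheory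
open Literature.AlgebraicGeometry.ShimuraVarieties
open Literature.AlgebraicTopology.SingularHomology
open Summit.HodgeConjecture.HodgeConjecture.Theses.EndoscopicMiddleDegree (OrthogonalEnveloped)
open Summit.HodgeConjecture.HodgeConjecture.Cruxes.OrthogonalEnveloped.ImpureBarrenEnvelope
  (stub_corrAlgebra gysinDiagonal_one_mem_algebraicClasses corrAction_gysinDiagonal_one)
open Summit.HodgeConjecture.HodgeConjecture.Cruxes.MiddleThetaSpan.ConjugateDimensionSieve
  (exists_primitiveCentralIdempotents)

/-! ## The registered stubs (signatures in tree vocabulary only) -/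

/-- **Stub 1 (shared with line `impure-barren-envelope`, byte-identical) — the Hecke correspondences
are algebraic, in push–pull form (KNOWN in print, a CONSTRUCTION missing in the tree: Shimura 1971
§7.3; BMM arXiv:1306.1515 Part 2 §1.8 / Thm 61; XL).** For `μ` with Poincaré duality, `m ∈ {1,2}`, a
datum `D` and an ADMISSIBLE `g ∉ Γ`, the Hecke operator `T_g` on `H^{2(m+1)}(X(ℂ); ℂ)` equals
`c • π₊ π'^*` for a smooth projective `S` of dimension `2(m+1)` (the level cover `S(Γ ∩ g⁻¹Γg)`,
algebraic by Baily–Borel + GAGA, finite étale over `X`), scheme morphisms `π π' : S ⟶ X`,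
`π₊ = complexGysin μ` and a scalar `c`. [cite: Shimura1973, Ch. 7 §7.3]
[cite: BergeronMillsonMoeglin2016Balls, Part 2 §1.8 and Thm. 61] -/
theorem stub_heckePushPull :
    ∀ (μ : OrientationFamily), μ.HasPoincareDuality →
      ∀ (m : ℕ) (X : SchemeOver ℂ) (D : UnitaryBallQuotientDatum (2 * (m + 1)) X), 1 ≤ m → m ≤ 2 →
        ∀ g : GL (Fin (2 * (m + 1) + 1)) D.E, D.IsHeckeAdmissible g → g ∉ D.Γ →
          ∃ (S : SchemeOver ℂ) (hS : IsSmoothProjective (2 * (m + 1)) S) (π π' : S ⟶ X) (c : ℂ),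
            D.heckeCorrespondenceAction (2 * (m + 1)) g =
              c • (complexGysin μ hS D.isSmoothProjective π
                  (rfl : 2 * (m + 1) + 2 * (2 * (m + 1)) = 2 * (m + 1) + 2 * (2 * (m + 1))) ∘ₗ
                (complexBetti.map π' (2 * (m + 1))).hom) := by
  sorry

/-- **Stub 2 (shared with line `impure-barren-envelope`, byte-identical) — cup products of algebraic
classes on the triple product are algebraic (KNOWN: Voisin II Prop. 9.20; Fulton §19.2 with the
moving lemma §11.4): the instance on `X ⊗ (X ⊗ X)`, `l = k = 2(m+1)`, of the route's support item
`CupProductAlgebraic` (stmt-HodgeConjecture-14350) — verbatim the hypothesis `hCUP` of the landed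
`stub_corrAlgebra`.** [cite: VoisinHodgeII2003, §9.2.4 Prop. 9.20] [cite: Fulton1998, §19.2] -/
theorem stub_cupTriple :
    ∀ (m : ℕ) (X : SchemeOver ℂ), IsSmoothProjective (2 * (m + 1)) X →
      ∀ a ∈ algebraicClasses (X ⊗ (X ⊗ X)) (2 * (m + 1)),
        ∀ b ∈ algebraicClasses (X ⊗ (X ⊗ X)) (2 * (m + 1)),
          cupProduct ((Nat.mul_add 2 (2 * (m + 1)) (2 * (m + 1))).symm :
              2 * (2 * (m + 1)) + 2 * (2 * (m + 1)) = 2 * (2 * (m + 1) + 2 * (m + 1))) a b ∈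
            algebraicClasses (X ⊗ (X ⊗ X)) (2 * (m + 1) + 2 * (m + 1)) := by
  sorry

/-- **Stub 3 — THE BET `TateOrthogonal(m)` (the card's Transfer; HC-strength on wide cores, free on
Tate-type pieces): theta-orthogonal rational Hodge classes on the sector are POTENTIALLY TATE.** For
realization data `E, B, C` (ℓ-adic cohomology with its Galois action, Betti–Hodge data, Artin
comparison — the accepted hypothesis structures of `Motives/HodgeClassesPotentiallyTate`),
`m ∈ {1,2}`, a datum `D` on `X` (`dim X = 2n`, `n = m+1`), a rational class `e ∈ H²ⁿ(X(ℂ); ℂ)` of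
type `(n,n)` with `e ∪ x = 0` for all `x` in the theta world
`TW(D) = SCⁿ(D) ⊔ SConⁿ(D) ⊔ Hdg^{m,m}_ℚ · N¹` (verbatim the crux's hypothesis), its rational Betti lift
`t` (`[ζ] = B.isoObj t`, `[ζ ⊗ 1] = e`), every finitely generated subfield `K ⊆ ℂ`, every smooth
projective model `X₀/K` of `X` and every prime `ℓ`: the Artin-comparison image of `1 ⊗ ι^* t` lies in
`Tateⁿ(X₀) ⊆ H²ⁿ_ét(X₀ ⊗ K̄, ℚ_ℓ)` (fixed by an open subgroup of `Gal(K̄/K)` after the `n`-fold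
cyclotomic twist). The sector-and-`⊥TW` instance of `HodgeClassesArePotentiallyTate`
(`stub_tateOrthogonal_of_potentiallyTate`); implied by HC on the sector (cycle classes are Tate,
`artinComparisonEquiv_cycleClass_mem_tateClasses`) and by "Hodge classes are absolute Hodge"
(Deligne, LNM 900, Prop. 2.9(b)); on a wide core (Disproof F5b) it says the core hosts no such `e`.
[cite: Deligne1982HodgeCycles, Prop. 2.9(b) and Thm. 2.11] [cite: Tate1994, §1]
[cite: BergeronMillsonMoeglin2016Balls, Thm. 61 and Prop. 80] -/
theorem stub_tateOrthogonal :
    ∀ (E : ∀ (K : Subfield ℂ) (ℓ : ℕ) [Fact ℓ.Prime], EtaleRealization K ℓ) (B : BettiHodgeData ℂ)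
      (C : ∀ (K : Subfield ℂ) (ℓ : ℕ) [Fact ℓ.Prime], ArtinComparison (E K ℓ) B K.subtype),
      AlgebraicClassesArePotentiallyTate E B C → B.IsSummitCompatible →
      ∀ (m : ℕ) (X : SchemeOver ℂ) (D : UnitaryBallQuotientDatum (2 * (m + 1)) X), 1 ≤ m → m ≤ 2 →
      ∀ e : complexBetti X (2 * (m + 1)), IsRationalClass e →
        IsOfHodgeType (2 * (m + 1)) X (2 * (m + 1)) (m + 1) (m + 1) e →
        (∀ x ∈ ((⨆ (W : Submodule D.E (Fin (2 * (m + 1) + 1) → D.E))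
              (_ : IsTotallyPositive (conjRingHom D.E) D.H W) (_ : Module.finrank D.E W = m + 1),
              classesSupportedOn X (D.specialSubvariety W) (2 * (m + 1))) ⊔
            (⨆ (W : Submodule D.E (Fin (2 * (m + 1) + 1) → D.E))
              (_ : IsTotallyPositive (conjRingHom D.E) D.H W) (_ : Module.finrank D.E W = m)
              (Z : Set X.left) (_ : IsClosed Z) (_ : Z ⊆ D.specialSubvariety W)
              (_ : ∀ z ∈ Z, ((m + 1 : ℕ) : ℕ∞) ≤ Order.coheight z),
              classesSupportedOn X Z (2 * (m + 1))) ⊔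
            Submodule.span ℂ {z : complexBetti X (2 * (m + 1)) |
              ∃ a : complexBetti X (2 * m), IsRationalClass a ∧
                IsOfHodgeType (2 * (m + 1)) X (2 * m) m m a ∧
                ∃ d ∈ algebraicClasses X 1,
                  z = cupProduct (two_mul_add_two_mul m 1) a d}),
            cupProduct (two_mul_add_two_mul (m + 1) (m + 1)) e x = 0) →
        ∀ (t : B.W.obj X (2 * (m + 1)))
          (ζ : singularCochainComplex.cocycles ℚ ℚ (ComplexPoints X) (2 * (m + 1))),
          singularCohomology.π ℚ ℚ (ComplexPoints X) (2 * (m + 1)) ζ = B.isoObj X (2 * (m + 1)) t →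
          singularCohomology.π ℂ ℂ (ComplexPoints X) (2 * (m + 1))
              (cocycleOfRat (ComplexPoints X) (2 * (m + 1)) ζ) = e →
          ∀ (K : Subfield ℂ) [Algebra.EssFiniteType ℤ K] (X₀ : SchemeOver K)
            (hX₀ : IsSmoothProjective (2 * (m + 1)) X₀) (ι : (baseChangeHom K.subtype).obj X₀ ≅ X)
            (ℓ : ℕ) [Fact ℓ.Prime],
            artinComparisonEquiv (E K ℓ) B K.subtype (C K ℓ) hX₀ (2 * (m + 1))
                ((1 : ℚ_[ℓ]) ⊗ₜ[ℚ] B.W.pullback ι.hom (2 * (m + 1)) t) ∈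
              (E K ℓ).tateClasses X₀ (m + 1) := by
  sorry

/-- **Stub 4 — GALOIS LEGIBILITY, all or nothing (paper THEOREM modulo R3–R5 and slot purity; L/XL).**
For `m ∈ {1,2}`, a datum `D`, a RATIONAL class `e ∈ H²ⁿ(X(ℂ); ℂ)` that is potentially Tate (for all
realization data, lifts, finitely generated models and primes, as in `stub_tateOrthogonal`), and a
ℚ-BLOCK `ε` of the Hecke algebra `𝓗 = Algebra.adjoin ℂ (range T_g)` (idempotent, central in `𝓗`,
rational-preserving, primitive among such — the blocks of the landed `stub_rationalBlocks`) that MEETS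
`e` (`ε e ≠ 0`): EVERY rational value `ε β` is potentially Tate. Paper proof at the intended
realization: `(ε H_ℚ) ⊗ ℚ_ℓ` is `G_{K'}`-stable (Hecke correspondences are `K̄`-rational) and contains
the non-zero Tate vector `ε_ℓ e_ℓ`; by the Kottwitz/Kisin–Shin–Zhu shape of `H²ⁿ_ét` (R3; Mok/KMSW for
the inner form) its constituents over one `π_f` of the block are `r_ℓ(μ_j)`(shift) for the summands
`μ_j ⊠ R_b` of the Arthur parameter whose Adams–Johnson member reaches degree `2n`; a Tate line forces a
constituent with a `U`-sub-character of parallel Hodge–Tate weight `n`, which for `dim μ_j ≥ 2` is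
excluded at a Patrikis–Taylor prime (R4: irreducible ⟹ by Clifford `r|_U` would be a sum of conjugate
parallel-weight characters, contradicting regularity R5) — so a CHARACTER owns the middle slot at
every embedding above `τ₁` for that `π_f`, and (the condition being stable under `Aut(ℂ)` on
coefficients) for every `π_f` of the ℚ-block: the block is Tate type, hence PURE `(n,n)` by the slot
census (Disproof F5: even blocks miss degree `2n`, odd blocks `∌ 0` carry the other `S_ψ`-character),
hence `(ε H) ⊗ ℚ_ℓ = A(n,n)`-multiplicity `⊗ χ₀ε^{-n}`: all Tate, at every `ℓ`. By-product (T) for the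
sibling crux stmt-14301: enveloped classes are Tate over `E‴(χ₀)`, the input SupersingularSeeds
consumes. [cite: arXiv:2110.05381, Thm. 1] [cite: arXiv:1307.1640, Thm. A]
[cite: arXiv:1507.01432, §8 Déf. 8.2 and Thm. 8.4] [cite: BergeronMillsonMoeglin2016Balls, Thm. 61] -/
theorem stub_tateAllOrNothing :
    ∀ (m : ℕ) (X : SchemeOver ℂ) (D : UnitaryBallQuotientDatum (2 * (m + 1)) X), 1 ≤ m → m ≤ 2 →
      ∀ e : complexBetti X (2 * (m + 1)), IsRationalClass e →
        (∀ (E : ∀ (K : Subfield ℂ) (ℓ : ℕ) [Fact ℓ.Prime], EtaleRealization K ℓ)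
            (B : BettiHodgeData ℂ)
            (C : ∀ (K : Subfield ℂ) (ℓ : ℕ) [Fact ℓ.Prime], ArtinComparison (E K ℓ) B K.subtype),
            AlgebraicClassesArePotentiallyTate E B C → B.IsSummitCompatible →
            ∀ (t : B.W.obj X (2 * (m + 1)))
            (ζ : singularCochainComplex.cocycles ℚ ℚ (ComplexPoints X) (2 * (m + 1))),
            singularCohomology.π ℚ ℚ (ComplexPoints X) (2 * (m + 1)) ζ = B.isoObj X (2 * (m + 1)) t →
            singularCohomology.π ℂ ℂ (ComplexPoints X) (2 * (m + 1))
                (cocycleOfRat (ComplexPoints X) (2 * (m + 1)) ζ) = e →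
            ∀ (K : Subfield ℂ) [Algebra.EssFiniteType ℤ K] (X₀ : SchemeOver K)
              (hX₀ : IsSmoothProjective (2 * (m + 1)) X₀) (ι : (baseChangeHom K.subtype).obj X₀ ≅ X)
              (ℓ : ℕ) [Fact ℓ.Prime],
              artinComparisonEquiv (E K ℓ) B K.subtype (C K ℓ) hX₀ (2 * (m + 1))
                  ((1 : ℚ_[ℓ]) ⊗ₜ[ℚ] B.W.pullback ι.hom (2 * (m + 1)) t) ∈
                (E K ℓ).tateClasses X₀ (m + 1)) →
        ∀ ε : Module.End ℂ (complexBetti X (2 * (m + 1))),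
          ε ∈ Algebra.adjoin ℂ (Set.range (D.heckeCorrespondenceAction (2 * (m + 1)))) →
          ε * ε = ε →
          (∀ T ∈ Algebra.adjoin ℂ (Set.range (D.heckeCorrespondenceAction (2 * (m + 1)))),
            T * ε = ε * T) →
          (∀ β, IsRationalClass β → IsRationalClass (ε β)) →
          (∀ f ∈ Algebra.adjoin ℂ (Set.range (D.heckeCorrespondenceAction (2 * (m + 1)))),
            f * f = f →
            (∀ T ∈ Algebra.adjoin ℂ (Set.range (D.heckeCorrespondenceAction (2 * (m + 1)))),
              T * f = f * T) →
            (∀ β, IsRationalClass β → IsRationalClass (f β)) → f * ε = 0 ∨ f * ε = ε) →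
          ε e ≠ 0 →
          ∀ (E : ∀ (K : Subfield ℂ) (ℓ : ℕ) [Fact ℓ.Prime], EtaleRealization K ℓ)
            (B : BettiHodgeData ℂ)
            (C : ∀ (K : Subfield ℂ) (ℓ : ℕ) [Fact ℓ.Prime], ArtinComparison (E K ℓ) B K.subtype),
            AlgebraicClassesArePotentiallyTate E B C → B.IsSummitCompatible →
            ∀ (β : complexBetti X (2 * (m + 1))), IsRationalClass β →
            ∀ (t : B.W.obj X (2 * (m + 1)))
              (ζ : singularCochainComplex.cocycles ℚ ℚ (ComplexPoints X) (2 * (m + 1))),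
              singularCohomology.π ℚ ℚ (ComplexPoints X) (2 * (m + 1)) ζ =
                B.isoObj X (2 * (m + 1)) t →
              singularCohomology.π ℂ ℂ (ComplexPoints X) (2 * (m + 1))
                  (cocycleOfRat (ComplexPoints X) (2 * (m + 1)) ζ) = ε β →
              ∀ (K : Subfield ℂ) [Algebra.EssFiniteType ℤ K] (X₀ : SchemeOver K)
                (hX₀ : IsSmoothProjective (2 * (m + 1)) X₀) (ι : (baseChangeHom K.subtype).obj X₀ ≅ X)
                (ℓ : ℕ) [Fact ℓ.Prime],
                artinComparisonEquiv (E K ℓ) B K.subtype (C K ℓ) hX₀ (2 * (m + 1))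
                    ((1 : ℚ_[ℓ]) ⊗ₜ[ℚ] B.W.pullback ι.hom (2 * (m + 1)) t) ∈
                  (E K ℓ).tateClasses X₀ (m + 1) := by
  sorry

/-- **Stub 5 — FALTINGS LEGIBILITY of an algebraically cut piece (paper THEOREM modulo R1–R2; L;
datum-free).** For `μ` with Poincaré duality, `X` smooth projective of dimension `2(m+1)`, an
ALGEBRAIC `γ ∈ N^{2(m+1)}H^{4(m+1)}((X ⊗ X)(ℂ); ℂ)` whose action `P = corrAction μ hX hX rfl γ` on
`H^{2(m+1)}(X(ℂ); ℂ)` preserves rational classes, and such that every rational value `P β` is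
potentially Tate (all realization data, lifts, finitely generated models, primes): `P` has purely
`(m+1, m+1)` image. Paper proof at the intended realization: `P|_{H_ℚ}` lies in the ℚ-span of actions
of `K̄`-cycles (specialisation; `(W ⊗ ℂ) ∩ End_ℚ = W`), so `V_ℓ := P(H_ℚ) ⊗ ℚ_ℓ ⊆ H_ét(X₀)` is
`G_{K'}`-stable for a finite `K'/K`; it is spanned by Tate vectors, hence an open subgroup acts on
`V_ℓ(m+1)` through a finite quotient, hence `V_ℓ` is Hodge–Tate of the single weight `m+1`; Faltings'
`C_HT` for `X₀/K'_v` (R1), compatible with cup products, pull-backs, Gysin maps and cycle classes,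
hence with `P` (R2: Tsuji, Nizioł), gives `P(H^{p,q}) ⊗ ℂ_ℓ(-p) = 0` for `p ≠ m+1` (GAGA), i.e.
`P(H) ⊆ H^{m+1,m+1}`. This is the card's lever ("the image of the envelope is a motive, legible on the
Hodge–Tate side") run Galois-to-Hodge; no Arthur parameters, no absolute Hodge input.
[cite: Faltings1988pAdicHodge, Thm. 1.1] [cite: arXiv:1804.03873, Thm. 1.1]
[cite: Deligne1982HodgeCycles, §2 Ex. 2.1(a)] -/
theorem stub_tatePure :
    ∀ (μ : OrientationFamily), μ.HasPoincareDuality →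
      ∀ (m : ℕ) (X : SchemeOver ℂ) (hX : IsSmoothProjective (2 * (m + 1)) X),
        ∀ γ ∈ algebraicClasses (X ⊗ X) (2 * (m + 1)),
          (∀ β, IsRationalClass β → IsRationalClass (corrAction μ hX hX
              (rfl : 2 * (m + 1) + 2 * (2 * (m + 1)) = 2 * (m + 1) + 2 * (2 * (m + 1))) γ β)) →
          (∀ (E : ∀ (K : Subfield ℂ) (ℓ : ℕ) [Fact ℓ.Prime], EtaleRealization K ℓ)
              (B : BettiHodgeData ℂ)
              (C : ∀ (K : Subfield ℂ) (ℓ : ℕ) [Fact ℓ.Prime], ArtinComparison (E K ℓ) B K.subtype),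
              AlgebraicClassesArePotentiallyTate E B C → B.IsSummitCompatible →
              ∀ (β : complexBetti X (2 * (m + 1))), IsRationalClass β →
              ∀ (t : B.W.obj X (2 * (m + 1)))
                (ζ : singularCochainComplex.cocycles ℚ ℚ (ComplexPoints X) (2 * (m + 1))),
                singularCohomology.π ℚ ℚ (ComplexPoints X) (2 * (m + 1)) ζ =
                  B.isoObj X (2 * (m + 1)) t →
                singularCohomology.π ℂ ℂ (ComplexPoints X) (2 * (m + 1))
                    (cocycleOfRat (ComplexPoints X) (2 * (m + 1)) ζ) =
                  corrAction μ hX hX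
                    (rfl : 2 * (m + 1) + 2 * (2 * (m + 1)) = 2 * (m + 1) + 2 * (2 * (m + 1))) γ β →
                ∀ (K : Subfield ℂ) [Algebra.EssFiniteType ℤ K] (X₀ : SchemeOver K)
                  (hX₀ : IsSmoothProjective (2 * (m + 1)) X₀)
                  (ι : (baseChangeHom K.subtype).obj X₀ ≅ X) (ℓ : ℕ) [Fact ℓ.Prime],
                  artinComparisonEquiv (E K ℓ) B K.subtype (C K ℓ) hX₀ (2 * (m + 1))
                      ((1 : ℚ_[ℓ]) ⊗ₜ[ℚ] B.W.pullback ι.hom (2 * (m + 1)) t) ∈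
                    (E K ℓ).tateClasses X₀ (m + 1)) →
          ∀ β, IsOfHodgeType (2 * (m + 1)) X (2 * (m + 1)) (m + 1) (m + 1)
            (corrAction μ hX hX
              (rfl : 2 * (m + 1) + 2 * (2 * (m + 1)) = 2 * (m + 1) + 2 * (2 * (m + 1))) γ β) := by
  sorry

/-! ## The ℚ-blocks of the Hecke algebra — VERBATIM COPY of the LANDED `stub_rationalBlocks` (p87916,
`Theorems/EndoscopicMiddleDegreeOrthogonalEnvelopedRationalBlocks.lean`, namespace `…ImpureBarrenEnvelope`)

Stub 6 of the planner's skeleton is LANDED and is no longer a stub of this line (rev L1). The farm snapshot does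
not yet serve that module to importing files (`remote:stale:…:unbuilt`, 2026-08-16T12:50Z), so its two helper
lemmas and the theorem are reproduced here byte-for-byte (theorem renamed `landed_rationalBlocks`, so that it is NOT
registered as a stub). Replace this section by the import as soon as it elaborates. -/

/-! ## Helper lemmas (worker): atoms of a finite Boolean algebra of idempotents -/

/-- **Products of partial sums of orthogonal idempotents.** If the elements of the finite family `z`
of a ring are idempotent and pairwise orthogonal, then for `K, L ⊆ z`:
`(Σ_{a ∈ K} a) (Σ_{b ∈ L} b) = Σ_{a ∈ K ∩ L} a`. [folklore] -/
theorem rationalBlocks_sum_mul_sum_eq_sum_inter {E : Type*} [Ring E] [DecidableEq E]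
    {z K L : Finset E} (hzi : ∀ a ∈ z, a * a = a) (hzo : ∀ a ∈ z, ∀ b ∈ z, a ≠ b → a * b = 0)
    (hK : K ⊆ z) (hL : L ⊆ z) :
    (∑ a ∈ K, a) * (∑ b ∈ L, b) = ∑ a ∈ K ∩ L, a := by
  rw [Finset.sum_mul_sum, ← Finset.sum_ite_mem]
  refine Finset.sum_congr rfl fun a ha => ?_
  calc ∑ b ∈ L, a * b = ∑ b ∈ L, (if a = b then a else 0) :=
        Finset.sum_congr rfl fun b hb => by
          split_ifs with h
          · subst h
            exact hzi a (hK ha)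
          · exact hzo a (hK ha) b (hL hb) h
    _ = if a ∈ L then a else 0 := Finset.sum_ite_eq L a fun _ => a

/-- **Atoms of a finite Boolean algebra of idempotents.** Let `P` be a property of elements of a
ring `E` stable under `1`, products and differences, and `z ⊆ E` a finite family of non-zero,
pairwise orthogonal idempotents with `Σ_{a ∈ z} a = 1`, *primitive towards `P`-idempotents*:
`f a ∈ {0, a}` for every idempotent `f` with `P f` and every `a ∈ z`. Then there is a finite family
`s` of pairwise orthogonal `P`-idempotents with `Σ_{e ∈ s} e = 1`, each primitive towards
`P`-idempotents (`f e ∈ {0, e}`). Construction: every `P`-idempotent is `z_K := Σ_{a ∈ K} a` for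
`K = {a ∈ z | f a = a}`; the subsets `K ⊆ z` with `P z_K` ("good") are stable under `∩`
(`z_K z_L = z_{K ∩ L}`) and differences (`z_{K ∖ L} = z_K - z_L`), and `z` is good (`z_z = 1`); the
blocks are the `z_A` over the ATOMS `A` (minimal non-empty good subsets), which are pairwise disjoint
and cover `z` (a good subset containing `a` of minimal cardinality is an atom); primitivity:
`z_K z_A = z_{K ∩ A}` and `K ∩ A ∈ {∅, A}` by minimality. [folklore] -/
theorem rationalBlocks_exists_finset_atoms {E : Type*} [Ring E] (P : E → Prop) (h1 : P 1)
    (hmul : ∀ a b, P a → P b → P (a * b)) (hsub : ∀ a b, P a → P b → P (a - b))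
    (z : Finset E) (hz0 : ∀ a ∈ z, a ≠ 0) (hzi : ∀ a ∈ z, a * a = a)
    (hzo : ∀ a ∈ z, ∀ b ∈ z, a ≠ b → a * b = 0) (hz1 : ∑ a ∈ z, a = 1)
    (hzp : ∀ f, P f → f * f = f → ∀ a ∈ z, f * a = 0 ∨ f * a = a) :
    ∃ s : Finset E,
      (∀ e ∈ s, P e ∧ e * e = e ∧ ∀ f, P f → f * f = f → f * e = 0 ∨ f * e = e) ∧
      (∀ e ∈ s, ∀ e' ∈ s, e ≠ e' → e * e' = 0) ∧ ∑ e ∈ s, e = 1 := by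
  classical
  -- `z_K z_L = z_{K ∩ L}` and `z_{K \ L} = z_K - z_L`
  have hmulσ : ∀ K L : Finset E, K ⊆ z → L ⊆ z →
      (∑ a ∈ K, a) * (∑ a ∈ L, a) = ∑ a ∈ K ∩ L, a :=
    fun K L hK hL => rationalBlocks_sum_mul_sum_eq_sum_inter hzi hzo hK hL
  have hsubσ : ∀ K L : Finset E, L ⊆ K → ∑ a ∈ K \ L, a = (∑ a ∈ K, a) - ∑ a ∈ L, a :=
    fun K L h => eq_sub_of_add_eq (Finset.sum_sdiff h)
  -- good subsets (`z_K` has `P`) and atoms (minimal non-empty good subsets)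
  let good : Finset E → Prop := fun K => K ⊆ z ∧ P (∑ a ∈ K, a)
  let atom : Finset E → Prop := fun A =>
    good A ∧ A.Nonempty ∧ ∀ K, good K → K ⊆ A → K.Nonempty → K = A
  have good_inter : ∀ K L : Finset E, good K → good L → good (K ∩ L) := fun K L hK hL =>
    ⟨Finset.inter_subset_left.trans hK.1, by
      rw [← hmulσ K L hK.1 hL.1]
      exact hmul _ _ hK.2 hL.2⟩
  have good_sdiff : ∀ K L : Finset E, good K → good L → L ⊆ K → good (K \ L) :=
    fun K L hK hL h =>
      ⟨Finset.sdiff_subset.trans hK.1, by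
        rw [hsubσ K L h]
        exact hsub _ _ hK.2 hL.2⟩
  have good_z : good z := ⟨Finset.Subset.refl _, by rw [hz1]; exact h1⟩
  -- two distinct atoms are disjoint
  have atom_disj : ∀ A A' : Finset E, atom A → atom A' → A ≠ A' → A ∩ A' = ∅ := by
    intro A A' hA hA' hne
    by_contra h
    have hn : (A ∩ A').Nonempty := Finset.nonempty_iff_ne_empty.mpr h
    have hg := good_inter A A' hA.1 hA'.1
    exact hne ((hA.2.2 _ hg Finset.inter_subset_left hn).symm.trans
      (hA'.2.2 _ hg Finset.inter_subset_right hn))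
  -- every `P`-idempotent is `z_K` for a good `K`
  have repr : ∀ f, P f → f * f = f → ∃ K : Finset E, good K ∧ ∑ a ∈ K, a = f := by
    intro f hf hff
    have key : f = ∑ a ∈ z.filter (fun a => f * a = a), a := by
      rw [Finset.sum_filter]
      calc f = f * ∑ a ∈ z, a := by rw [hz1, mul_one]
        _ = ∑ a ∈ z, f * a := Finset.mul_sum _ _ _
        _ = ∑ a ∈ z, if f * a = a then a else 0 := Finset.sum_congr rfl fun a ha => by
          rcases hzp f hf hff a ha with h | h
          · rw [h]
            split_ifs with h'
            · exact h'
            · rfl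
          · rw [h, if_pos rfl]
    exact ⟨_, ⟨Finset.filter_subset _ _, by rw [← key]; exact hf⟩, key.symm⟩
  -- every element of `z` lies in an atom: a good subset containing it of minimal cardinality
  have cover : ∀ a ∈ z, ∃ A : Finset E, atom A ∧ a ∈ A := by
    intro a ha
    obtain ⟨A, hA, hmin⟩ := Finset.exists_min_image
      (z.powerset.filter fun K => good K ∧ a ∈ K) Finset.card
      ⟨z, Finset.mem_filter.mpr ⟨Finset.mem_powerset.mpr (Finset.Subset.refl _), good_z, ha⟩⟩
    obtain ⟨-, hAg, haA⟩ := Finset.mem_filter.mp hA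
    have hmin' : ∀ K, good K → a ∈ K → ¬ K ⊂ A := fun K hK haK hlt =>
      not_le.mpr (Finset.card_lt_card hlt)
        (hmin K (Finset.mem_filter.mpr ⟨Finset.mem_powerset.mpr hK.1, hK, haK⟩))
    refine ⟨A, ⟨hAg, ⟨a, haA⟩, fun K hK hKA hKn => ?_⟩, haA⟩
    by_contra hne
    by_cases haK : a ∈ K
    · exact hmin' K hK haK (Finset.ssubset_iff_subset_ne.mpr ⟨hKA, hne⟩)
    · exact hmin' (A \ K) (good_sdiff A K hAg hK hKA) (Finset.mem_sdiff.mpr ⟨haA, haK⟩)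
        (Finset.sdiff_ssubset hKA hKn)
  -- the blocks: `z_A` over the atoms `A`
  set 𝒜 : Finset (Finset E) := z.powerset.filter atom
  have mem𝒜 : ∀ A, A ∈ 𝒜 ↔ atom A := fun A =>
    ⟨fun h => (Finset.mem_filter.mp h).2,
      fun h => Finset.mem_filter.mpr ⟨Finset.mem_powerset.mpr h.1.1, h⟩⟩
  refine ⟨𝒜.image fun A => ∑ a ∈ A, a, ?_, ?_, ?_⟩
  · -- `P`, idempotent, primitive towards `P`-idempotents
    intro e he
    obtain ⟨A, hA, rfl⟩ := Finset.mem_image.mp he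
    rw [mem𝒜] at hA
    refine ⟨hA.1.2, by rw [hmulσ A A hA.1.1 hA.1.1, Finset.inter_self], fun f hf hff => ?_⟩
    obtain ⟨K, hK, rfl⟩ := repr f hf hff
    rw [hmulσ K A hK.1 hA.1.1]
    by_cases hKA : (K ∩ A).Nonempty
    · exact Or.inr (by rw [hA.2.2 _ (good_inter K A hK hA.1) Finset.inter_subset_right hKA])
    · exact Or.inl (by rw [Finset.not_nonempty_iff_eq_empty.mp hKA, Finset.sum_empty])
  · -- pairwise orthogonal
    intro e he e' he' hne
    obtain ⟨A, hA, rfl⟩ := Finset.mem_image.mp he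
    obtain ⟨A', hA', rfl⟩ := Finset.mem_image.mp he'
    rw [mem𝒜] at hA hA'
    rw [hmulσ A A' hA.1.1 hA'.1.1, atom_disj A A' hA hA' (fun h => hne (by rw [h])),
      Finset.sum_empty]
  · -- `Σ_A z_A = z_{⋃ A} = z_z = 1`
    have hdisj : (↑𝒜 : Set (Finset E)).PairwiseDisjoint id := fun A hA A' hA' hne =>
      Finset.disjoint_iff_inter_eq_empty.mpr
        (atom_disj A A' ((mem𝒜 A).mp hA) ((mem𝒜 A').mp hA') hne)
    have hinj : Set.InjOn (fun A : Finset E => ∑ a ∈ A, a) ↑𝒜 := by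
      intro A hA A' hA' hAA'
      have hAA' : ∑ a ∈ A, a = ∑ a ∈ A', a := hAA'
      by_contra hne
      have hA := (mem𝒜 A).mp hA
      have hA' := (mem𝒜 A').mp hA'
      obtain ⟨a, haA⟩ := hA.2.1
      have h0 : ∑ x ∈ A, x = 0 := by
        calc ∑ x ∈ A, x = (∑ x ∈ A, x) * ∑ x ∈ A', x := by
              rw [← hAA', hmulσ A A hA.1.1 hA.1.1, Finset.inter_self]
          _ = 0 := by
              rw [hmulσ A A' hA.1.1 hA'.1.1, atom_disj A A' hA hA' hne, Finset.sum_empty]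
      have ha0 : a = 0 := by
        calc a = ∑ x ∈ A ∩ {a}, x := by
              rw [Finset.inter_singleton_of_mem haA, Finset.sum_singleton]
          _ = (∑ x ∈ A, x) * ∑ x ∈ ({a} : Finset E), x :=
              (hmulσ A {a} hA.1.1 (Finset.singleton_subset_iff.mpr (hA.1.1 haA))).symm
          _ = 0 := by rw [h0, zero_mul]
      exact hz0 a (hA.1.1 haA) ha0
    have hcov : 𝒜.biUnion id = z := by
      refine Finset.Subset.antisymm
        (Finset.biUnion_subset.mpr fun A hA => ((mem𝒜 A).mp hA).1.1) fun a ha => ?_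
      obtain ⟨A, hA, haA⟩ := cover a ha
      exact Finset.mem_biUnion.mpr ⟨A, (mem𝒜 A).mpr hA, haA⟩
    rw [Finset.sum_image hinj]
    calc ∑ A ∈ 𝒜, ∑ a ∈ A, a = ∑ a ∈ 𝒜.biUnion id, a := (Finset.sum_biUnion hdisj).symm
      _ = 1 := by rw [hcov, hz1]

/-! ## The registered stub (signature must stay BYTE-IDENTICAL) -/

/-- **Stub 4 — the ℚ-block decomposition of the Hecke algebra (KNOWN: the `ℚ`-Hecke-isotypic pieces,
BMM Part 2 §1.9 / Thm 61; finite-dimensional linear algebra in Lean).** For `m ∈ {1,2}` and a datum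
`D`, let `𝓗 = Algebra.adjoin ℂ (range (D.heckeCorrespondenceAction (2n)))` on `H = H²ⁿ(X(ℂ); ℂ)`,
`n = m + 1`. There is a finite family `s` of pairwise orthogonal endomorphisms summing to `1`, each of
which lies in `𝓗`, is idempotent, central in `𝓗`, preserves rational classes, and is PRIMITIVE among
the rational-preserving central idempotents `f` of `𝓗` (`f ε ∈ {0, ε}`). Proof: `H` is
finite-dimensional (`finite_complexBetti D.isSmoothProjective`), so `𝓗` has `ℂ`-block idempotents
(`exists_primitiveCentralIdempotents`: non-zero, pairwise orthogonal central idempotents summing to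
`1`, primitive among central idempotents); the `ℚ`-blocks are the sums of `ℂ`-blocks over the atoms of
the finite Boolean algebra of those subsets whose sum preserves rational classes
(`rationalBlocks_exists_finset_atoms` with `P` = "central in `𝓗` and rational-preserving", stable
under `1`, products and differences by `IsRationalClass.add/.smul`).
[cite: BergeronMillsonMoeglin2016Balls, Part 2 §1.9 and Thm. 61] -/
theorem landed_rationalBlocks :
    ∀ (m : ℕ) (X : SchemeOver ℂ) (D : UnitaryBallQuotientDatum (2 * (m + 1)) X), 1 ≤ m → m ≤ 2 →
      ∃ s : Finset (Module.End ℂ (complexBetti X (2 * (m + 1)))),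
        (∀ ε ∈ s,
          ε ∈ Algebra.adjoin ℂ (Set.range (D.heckeCorrespondenceAction (2 * (m + 1)))) ∧
          ε * ε = ε ∧
          (∀ T ∈ Algebra.adjoin ℂ (Set.range (D.heckeCorrespondenceAction (2 * (m + 1)))),
            T * ε = ε * T) ∧
          (∀ β, IsRationalClass β → IsRationalClass (ε β)) ∧
          (∀ f ∈ Algebra.adjoin ℂ (Set.range (D.heckeCorrespondenceAction (2 * (m + 1)))),
            f * f = f →
            (∀ T ∈ Algebra.adjoin ℂ (Set.range (D.heckeCorrespondenceAction (2 * (m + 1)))),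
              T * f = f * T) →
            (∀ β, IsRationalClass β → IsRationalClass (f β)) → f * ε = 0 ∨ f * ε = ε)) ∧
        (∀ ε ∈ s, ∀ ε' ∈ s, ε ≠ ε' → ε * ε' = 0) ∧
        ∑ ε ∈ s, ε = 1 := by
  intro m X D _ _
  haveI := finite_complexBetti D.isSmoothProjective (2 * (m + 1))
  set 𝓗 := Algebra.adjoin ℂ (Set.range (D.heckeCorrespondenceAction (2 * (m + 1))))
  -- the `ℂ`-blocks: primitive central idempotents of `𝓗`
  obtain ⟨z, hz, hz1⟩ := exists_primitiveCentralIdempotents 𝓗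
  -- rational classes are stable under differences
  have rat_sub : ∀ x y : complexBetti X (2 * (m + 1)), IsRationalClass x → IsRationalClass y →
      IsRationalClass (x - y) := fun x y hx hy => by
    have h := hx.add (hy.smul (-1))
    rwa [Rat.cast_neg, Rat.cast_one, neg_one_smul, ← sub_eq_add_neg] at h
  -- the atoms of the Boolean algebra of rational-preserving central idempotents
  obtain ⟨s, hs, ho, hsum⟩ := rationalBlocks_exists_finset_atoms
    (fun T : Module.End ℂ (complexBetti X (2 * (m + 1))) =>
      T ∈ 𝓗 ∧ (∀ S ∈ 𝓗, S * T = T * S) ∧ ∀ β, IsRationalClass β → IsRationalClass (T β))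
    ⟨𝓗.one_mem, fun S _ => by rw [mul_one, one_mul], fun β hβ => by
      rwa [Module.End.one_apply]⟩
    (fun a b ha hb => ⟨𝓗.mul_mem ha.1 hb.1,
      fun S hS => by rw [← mul_assoc, ha.2.1 S hS, mul_assoc, hb.2.1 S hS, mul_assoc],
      fun β hβ => by
        rw [Module.End.mul_apply]
        exact ha.2.2 _ (hb.2.2 β hβ)⟩)
    (fun a b ha hb => ⟨𝓗.sub_mem ha.1 hb.1,
      fun S hS => by rw [mul_sub, sub_mul, ha.2.1 S hS, hb.2.1 S hS],
      fun β hβ => by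
        rw [LinearMap.sub_apply]
        exact rat_sub _ _ (ha.2.2 β hβ) (hb.2.2 β hβ)⟩)
    z (fun a ha => (hz a ha).2.1) (fun a ha => (hz a ha).1.2.1)
    (fun a ha b hb hab => by
      -- distinct primitive central idempotents are orthogonal
      have hcomm : b * a = a * b := (hz a ha).1.2.2 b (hz b hb).1.1
      rcases (hz b hb).2.2 a (hz a ha).1 with h | h
      · exact h
      · rcases (hz a ha).2.2 b (hz b hb).1 with h' | h'
        · rw [← hcomm]
          exact h'
        · exact absurd (h'.symm.trans (hcomm.trans h)) hab)
    hz1 (fun f hf hff a ha => (hz a ha).2.2 f ⟨hf.1, hff, hf.2.1⟩)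
  refine ⟨s, fun ε hε => ?_, ho, hsum⟩
  obtain ⟨⟨h1, h2, h3⟩, h4, h5⟩ := hs ε hε
  exact ⟨h1, h4, h2, h3, fun f hf hff hfc hfr => h5 f ⟨hf, hfc, hfr⟩ hff⟩


/-! ## Sanity: the bet is an instance of "Hodge classes are potentially Tate" and is HC-implied -/

/-- The statement of `stub_tateOrthogonal`, NAMED — used only by the two sanity theorems below (the
registered stub and the composition spell it out). [cite: Deligne1982HodgeCycles, Prop. 2.9(b)] -/
def TateOrthogonal : Prop :=
    ∀ (E : ∀ (K : Subfield ℂ) (ℓ : ℕ) [Fact ℓ.Prime], EtaleRealization K ℓ) (B : BettiHodgeData ℂ)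
      (C : ∀ (K : Subfield ℂ) (ℓ : ℕ) [Fact ℓ.Prime], ArtinComparison (E K ℓ) B K.subtype),
      AlgebraicClassesArePotentiallyTate E B C → B.IsSummitCompatible →
      ∀ (m : ℕ) (X : SchemeOver ℂ) (D : UnitaryBallQuotientDatum (2 * (m + 1)) X), 1 ≤ m → m ≤ 2 →
      ∀ e : complexBetti X (2 * (m + 1)), IsRationalClass e →
        IsOfHodgeType (2 * (m + 1)) X (2 * (m + 1)) (m + 1) (m + 1) e →
        (∀ x ∈ ((⨆ (W : Submodule D.E (Fin (2 * (m + 1) + 1) → D.E))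
              (_ : IsTotallyPositive (conjRingHom D.E) D.H W) (_ : Module.finrank D.E W = m + 1),
              classesSupportedOn X (D.specialSubvariety W) (2 * (m + 1))) ⊔
            (⨆ (W : Submodule D.E (Fin (2 * (m + 1) + 1) → D.E))
              (_ : IsTotallyPositive (conjRingHom D.E) D.H W) (_ : Module.finrank D.E W = m)
              (Z : Set X.left) (_ : IsClosed Z) (_ : Z ⊆ D.specialSubvariety W)
              (_ : ∀ z ∈ Z, ((m + 1 : ℕ) : ℕ∞) ≤ Order.coheight z),
              classesSupportedOn X Z (2 * (m + 1))) ⊔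
            Submodule.span ℂ {z : complexBetti X (2 * (m + 1)) |
              ∃ a : complexBetti X (2 * m), IsRationalClass a ∧
                IsOfHodgeType (2 * (m + 1)) X (2 * m) m m a ∧
                ∃ d ∈ algebraicClasses X 1,
                  z = cupProduct (two_mul_add_two_mul m 1) a d}),
            cupProduct (two_mul_add_two_mul (m + 1) (m + 1)) e x = 0) →
        ∀ (t : B.W.obj X (2 * (m + 1)))
          (ζ : singularCochainComplex.cocycles ℚ ℚ (ComplexPoints X) (2 * (m + 1))),
          singularCohomology.π ℚ ℚ (ComplexPoints X) (2 * (m + 1)) ζ = B.isoObj X (2 * (m + 1)) t →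
          singularCohomology.π ℂ ℂ (ComplexPoints X) (2 * (m + 1))
              (cocycleOfRat (ComplexPoints X) (2 * (m + 1)) ζ) = e →
          ∀ (K : Subfield ℂ) [Algebra.EssFiniteType ℤ K] (X₀ : SchemeOver K)
            (hX₀ : IsSmoothProjective (2 * (m + 1)) X₀) (ι : (baseChangeHom K.subtype).obj X₀ ≅ X)
            (ℓ : ℕ) [Fact ℓ.Prime],
            artinComparisonEquiv (E K ℓ) B K.subtype (C K ℓ) hX₀ (2 * (m + 1))
                ((1 : ℚ_[ℓ]) ⊗ₜ[ℚ] B.W.pullback ι.hom (2 * (m + 1)) t) ∈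
              (E K ℓ).tateClasses X₀ (m + 1)

/-- `TateOrthogonal` IS the statement of `stub_tateOrthogonal` (`Iff.rfl`). [folklore] -/
theorem tateOrthogonal_iff : TateOrthogonal ↔
    ∀ (E : ∀ (K : Subfield ℂ) (ℓ : ℕ) [Fact ℓ.Prime], EtaleRealization K ℓ) (B : BettiHodgeData ℂ)
      (C : ∀ (K : Subfield ℂ) (ℓ : ℕ) [Fact ℓ.Prime], ArtinComparison (E K ℓ) B K.subtype),
      AlgebraicClassesArePotentiallyTate E B C → B.IsSummitCompatible →
      ∀ (m : ℕ) (X : SchemeOver ℂ) (D : UnitaryBallQuotientDatum (2 * (m + 1)) X), 1 ≤ m → m ≤ 2 →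
      ∀ e : complexBetti X (2 * (m + 1)), IsRationalClass e →
        IsOfHodgeType (2 * (m + 1)) X (2 * (m + 1)) (m + 1) (m + 1) e →
        (∀ x ∈ ((⨆ (W : Submodule D.E (Fin (2 * (m + 1) + 1) → D.E))
              (_ : IsTotallyPositive (conjRingHom D.E) D.H W) (_ : Module.finrank D.E W = m + 1),
              classesSupportedOn X (D.specialSubvariety W) (2 * (m + 1))) ⊔
            (⨆ (W : Submodule D.E (Fin (2 * (m + 1) + 1) → D.E))
              (_ : IsTotallyPositive (conjRingHom D.E) D.H W) (_ : Module.finrank D.E W = m)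
              (Z : Set X.left) (_ : IsClosed Z) (_ : Z ⊆ D.specialSubvariety W)
              (_ : ∀ z ∈ Z, ((m + 1 : ℕ) : ℕ∞) ≤ Order.coheight z),
              classesSupportedOn X Z (2 * (m + 1))) ⊔
            Submodule.span ℂ {z : complexBetti X (2 * (m + 1)) |
              ∃ a : complexBetti X (2 * m), IsRationalClass a ∧
                IsOfHodgeType (2 * (m + 1)) X (2 * m) m m a ∧
                ∃ d ∈ algebraicClasses X 1,
                  z = cupProduct (two_mul_add_two_mul m 1) a d}),
            cupProduct (two_mul_add_two_mul (m + 1) (m + 1)) e x = 0) →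
        ∀ (t : B.W.obj X (2 * (m + 1)))
          (ζ : singularCochainComplex.cocycles ℚ ℚ (ComplexPoints X) (2 * (m + 1))),
          singularCohomology.π ℚ ℚ (ComplexPoints X) (2 * (m + 1)) ζ = B.isoObj X (2 * (m + 1)) t →
          singularCohomology.π ℂ ℂ (ComplexPoints X) (2 * (m + 1))
              (cocycleOfRat (ComplexPoints X) (2 * (m + 1)) ζ) = e →
          ∀ (K : Subfield ℂ) [Algebra.EssFiniteType ℤ K] (X₀ : SchemeOver K)
            (hX₀ : IsSmoothProjective (2 * (m + 1)) X₀) (ι : (baseChangeHom K.subtype).obj X₀ ≅ X)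
            (ℓ : ℕ) [Fact ℓ.Prime],
            artinComparisonEquiv (E K ℓ) B K.subtype (C K ℓ) hX₀ (2 * (m + 1))
                ((1 : ℚ_[ℓ]) ⊗ₜ[ℚ] B.W.pullback ι.hom (2 * (m + 1)) t) ∈
              (E K ℓ).tateClasses X₀ (m + 1) :=
  Iff.rfl

/-- **The bet is the sector-and-`⊥TW` instance of "Hodge classes are potentially Tate"**
(Deligne, LNM 900, Prop. 2.9(b); Charles–Schnell Conj. 11.2.17; the crux
`HodgeClassesPotentiallyTate` of route LosTransfer, stmt-HodgeConjecture-2402): if every Hodge class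
on every smooth projective complex variety is potentially Tate for the realization data `E, B, C`,
then `TateOrthogonal` holds (specialise to `p = m + 1`, `hX = D.isSmoothProjective`; the orthogonality
hypothesis and the two guards on `(E, B, C)` are discarded).
[cite: Deligne1982HodgeCycles, Prop. 2.9(b)] [cite: CharlesSchnell2014Notes, §11.2.5 Conj. 11.2.17] -/
theorem tateOrthogonal_of_potentiallyTate
    (h : ∀ (E : ∀ (K : Subfield ℂ) (ℓ : ℕ) [Fact ℓ.Prime], EtaleRealization K ℓ)
      (B : BettiHodgeData ℂ)
      (C : ∀ (K : Subfield ℂ) (ℓ : ℕ) [Fact ℓ.Prime], ArtinComparison (E K ℓ) B K.subtype)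
      (n : ℕ) (X : SchemeOver ℂ), IsSmoothProjective n X → HodgeClassesArePotentiallyTate E B C n X) :
    TateOrthogonal := by
  intro E B C _ _ m X D _ _ e he hH _ t ζ ht hc K _ X₀ hX₀ ι ℓ _
  exact h E B C (2 * (m + 1)) X D.isSmoothProjective (m + 1) e he hH t ζ ht hc K X₀ hX₀ ι ℓ

/-- **The bet is implied by the Hodge conjecture in the middle degree of the sector** — Disproof F1
("the crux FOLLOWS from HC on the sector; no kill short of `¬HC`") holds for this stub VERBATIM and
in Lean: an algebraic rational class is potentially Tate for every realization datum satisfying the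
two guards (`AlgebraicClassesArePotentiallyTate.summit`: complex cycles specialise to `K̄`-cycles,
whose classes are Galois invariant on an open subgroup — Deligne, LNM 900, Ex. 2.1(a), Prop. 2.9(b)).
The hypothesis `hHC` is literally the conclusion of the route's target `MiddleDegreeStep` (as in
`Disproof.orthogonalEnveloped_of_middleHC`). [cite: Deligne1982HodgeCycles, §2 Ex. 2.1(a) and Prop. 2.9(b)] -/
theorem tateOrthogonal_of_middleHC
    (hHC : ∀ (m : ℕ) (X : SchemeOver ℂ), Nonempty (UnitaryBallQuotientDatum (2 * (m + 1)) X) →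
      1 ≤ m → m ≤ 2 → ∀ e : complexBetti X (2 * (m + 1)), IsRationalClass e →
      IsOfHodgeType (2 * (m + 1)) X (2 * (m + 1)) (m + 1) (m + 1) e →
      e ∈ algebraicClasses X (m + 1)) :
    TateOrthogonal := by
  intro E B C hA hB m X D hm1 hm2 e he hH _ t ζ ht hc K _ X₀ hX₀ ι ℓ _
  exact hA.summit hB D.isSmoothProjective (hHC m X ⟨D⟩ hm1 hm2 e he hH) ht hc K hX₀ ι ℓ

/-! ## Hecke operators are actions of algebraic self-correspondences (from Stub 1 + Literature) -/

/-- **Hecke operators are actions of algebraic self-correspondences**: `T_g = P_γ` for an algebraic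
`γ ∈ N^{2(m+1)} H^{4(m+1)}((X ⊗ X)(ℂ); ℂ)` — `γ = 0` for non-admissible `g` (`T_g = 0`, junk value),
`γ = Δ₊ 1` for `g ∈ Γ` (`T_g = 1`, `corrAction_gysinDiagonal_one`, landed), and `γ = c • (π, π')₊ 1` for
admissible `g ∉ Γ` by `stub_heckePushPull` and the landed push–pull
`exists_algebraic_corrAction_eq_of_pushPull` (Literature `CorrespondenceActionOfGraph`).
[cite: BergeronMillsonMoeglin2016Balls, Part 2 §1.8 and Thm. 61] [cite: Fulton1998, §16.1 Prop. 16.1.1] -/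
theorem heckeGraphAlgebraic
    (hPP : ∀ (μ : OrientationFamily), μ.HasPoincareDuality →
      ∀ (m : ℕ) (X : SchemeOver ℂ) (D : UnitaryBallQuotientDatum (2 * (m + 1)) X), 1 ≤ m → m ≤ 2 →
        ∀ g : GL (Fin (2 * (m + 1) + 1)) D.E, D.IsHeckeAdmissible g → g ∉ D.Γ →
          ∃ (S : SchemeOver ℂ) (hS : IsSmoothProjective (2 * (m + 1)) S) (π π' : S ⟶ X) (c : ℂ),
            D.heckeCorrespondenceAction (2 * (m + 1)) g =
              c • (complexGysin μ hS D.isSmoothProjective π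
                  (rfl : 2 * (m + 1) + 2 * (2 * (m + 1)) = 2 * (m + 1) + 2 * (2 * (m + 1))) ∘ₗ
                (complexBetti.map π' (2 * (m + 1))).hom))
    {μ : OrientationFamily} (hμ : μ.HasPoincareDuality) {m : ℕ} {X : SchemeOver ℂ}
    (D : UnitaryBallQuotientDatum (2 * (m + 1)) X) (hm1 : 1 ≤ m) (hm2 : m ≤ 2)
    (g : GL (Fin (2 * (m + 1) + 1)) D.E) :
    ∃ γ ∈ algebraicClasses (X ⊗ X) (2 * (m + 1)),
      corrAction μ D.isSmoothProjective D.isSmoothProjective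
          (rfl : 2 * (m + 1) + 2 * (2 * (m + 1)) = 2 * (m + 1) + 2 * (2 * (m + 1))) γ =
        D.heckeCorrespondenceAction (2 * (m + 1)) g := by
  by_cases hadm : D.IsHeckeAdmissible g
  · by_cases hg : g ∈ D.Γ
    · refine ⟨_, gysinDiagonal_one_mem_algebraicClasses μ hμ D.isSmoothProjective, ?_⟩
      rw [corrAction_gysinDiagonal_one hμ D.isSmoothProjective (2 * (m + 1)),
        D.heckeCorrespondenceAction_of_mem hg]
      rfl
    · exact exists_algebraic_corrAction_eq_of_pushPull hμ D.isSmoothProjective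
        (hPP μ hμ m X D hm1 hm2 g hadm hg)
  · exact ⟨0, zero_mem _, by rw [map_zero, D.heckeCorrespondenceAction_of_not hadm]⟩

/-! ## The composition -/

/-- **The crux from the stubs** (line `hodge-tate-legible-envelope`). With the ℚ-blocks `ε` of the
Hecke algebra (`stub_rationalBlocks`, landed), each the action of an algebraic class `γ_ε`
(`heckeGraphAlgebraic` from Stub 1 + the landed `stub_corrAlgebra` fed by Stub 2: the Hecke algebra
lies in the subalgebra of actions of algebraic self-correspondences), the envelope of `e` is
`γ := Σ_{ε e ≠ 0} γ_ε`. Its action `P = Σ_{live} ε` preserves rational classes (blocks do) and fixes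
`e` (`Σ_all ε = 1`, dead blocks kill `e` by definition). Each LIVE block is pure `(n,n)`:
`stub_tatePure` applied to `γ_ε`, whose hypothesis "every rational value of `ε` is potentially Tate"
is `stub_tateAllOrNothing` at the witness `e`, itself potentially Tate by the bet
`stub_tateOrthogonal` (this is where `e` rational, of type `(n,n)` and `⊥ TW(D)` are consumed). A sum
of `(n,n)`-classes is `(n,n)` (tested in one Hodge model, `isOfHodgeType_iff_mem_hodgePQ`).
[cite: BergeronMillsonMoeglin2016Balls, Thm. 61] [cite: Deligne1982HodgeCycles, Prop. 2.9(b)] -/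
theorem OrthogonalEnveloped_of : OrthogonalEnveloped := by
  intro μ hμ m X D hm1 hm2 e he hH horth
  classical
  -- the ℚ-blocks of the Hecke algebra (`stub_rationalBlocks`, landed p87916)
  obtain ⟨s, hblk, -, hsum⟩ := landed_rationalBlocks m X D hm1 hm2
  -- the subalgebra of actions of algebraic self-correspondences (landed `stub_corrAlgebra` + Stub 2)
  obtain ⟨⟨δ, hδ, hδid⟩, hcomp⟩ :=
    stub_corrAlgebra μ hμ m X D.isSmoothProjective (stub_cupTriple m X D.isSmoothProjective)
  let S : Subalgebra ℂ (Module.End ℂ (complexBetti X (2 * (m + 1)))) :=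
    { carrier := {T | ∃ γ ∈ algebraicClasses (X ⊗ X) (2 * (m + 1)),
        corrAction μ D.isSmoothProjective D.isSmoothProjective
          (rfl : 2 * (m + 1) + 2 * (2 * (m + 1)) = 2 * (m + 1) + 2 * (2 * (m + 1))) γ = T}
      mul_mem' := by
        rintro _ _ ⟨γ, hγ, rfl⟩ ⟨γ', hγ', rfl⟩
        exact hcomp γ hγ γ' hγ'
      one_mem' := ⟨δ, hδ, hδid⟩
      add_mem' := by
        rintro _ _ ⟨γ, hγ, rfl⟩ ⟨γ', hγ', rfl⟩
        exact ⟨γ + γ', add_mem hγ hγ', map_add _ _ _⟩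
      zero_mem' := ⟨0, zero_mem _, map_zero _⟩
      algebraMap_mem' := fun c ↦ ⟨c • δ, Submodule.smul_mem _ c hδ, by
        rw [map_smul, hδid, Algebra.algebraMap_eq_smul_one]; rfl⟩ }
  -- … contains the Hecke algebra (Stub 1 through `heckeGraphAlgebraic`)
  have hle : Algebra.adjoin ℂ (Set.range (D.heckeCorrespondenceAction (2 * (m + 1)))) ≤ S := by
    refine Algebra.adjoin_le ?_
    rintro _ ⟨g, rfl⟩
    exact heckeGraphAlgebraic stub_heckePushPull hμ D hm1 hm2 g
  -- each block is the action of an algebraic class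
  have hεS : ∀ ε ∈ s, ∃ γ ∈ algebraicClasses (X ⊗ X) (2 * (m + 1)),
      corrAction μ D.isSmoothProjective D.isSmoothProjective
        (rfl : 2 * (m + 1) + 2 * (2 * (m + 1)) = 2 * (m + 1) + 2 * (2 * (m + 1))) γ = ε :=
    fun ε hε ↦ hle (hblk ε hε).1
  choose! γf hγf hPγ using hεS
  -- the LIVE blocks (those meeting `e`) and the envelope `γ := Σ_{live} γ_ε`
  let live : Module.End ℂ (complexBetti X (2 * (m + 1))) → Prop := fun ε ↦ ε e ≠ 0
  have hP : corrAction μ D.isSmoothProjective D.isSmoothProjective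
      (rfl : 2 * (m + 1) + 2 * (2 * (m + 1)) = 2 * (m + 1) + 2 * (2 * (m + 1)))
      (∑ ε ∈ s.filter live, γf ε) = ∑ ε ∈ s.filter live, ε := by
    rw [map_sum]
    exact Finset.sum_congr rfl fun ε hε ↦ hPγ ε (Finset.mem_filter.1 hε).1
  -- every live block is PURE: Faltings legibility ← Galois legibility ← the bet
  have hpure : ∀ ε ∈ s.filter live, ∀ β,
      IsOfHodgeType (2 * (m + 1)) X (2 * (m + 1)) (m + 1) (m + 1) (ε β) := by
    intro ε hε β
    obtain ⟨hεs, hlive⟩ := Finset.mem_filter.1 hε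
    obtain ⟨h1, h2, h3, h4, h5⟩ := hblk ε hεs
    have key := stub_tatePure μ hμ m X D.isSmoothProjective (γf ε) (hγf ε hεs)
      (fun β hβ ↦ by rw [hPγ ε hεs]; exact h4 β hβ)
      (by
        intro E B C hA hB β' hβ' t ζ ht hc K _ X₀ hX₀ ι ℓ _
        rw [hPγ ε hεs] at hc
        exact stub_tateAllOrNothing m X D hm1 hm2 e he
          (by
            intro E' B' C' hA' hB' t' ζ' ht' hc' K' _ X₀' hX₀' ι' ℓ' _
            exact stub_tateOrthogonal E' B' C' hA' hB' m X D hm1 hm2 e he hH horth t' ζ' ht' hc' K' X₀' hX₀' ι' ℓ')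
          ε h1 h2 h3 h4 h5 hlive E B C hA hB β' hβ' t ζ ht hc K X₀ hX₀ ι ℓ)
      β
    rwa [hPγ ε hεs] at key
  refine ⟨∑ ε ∈ s.filter live, γf ε,
    Submodule.sum_mem _ fun ε hε ↦ hγf ε (Finset.mem_filter.1 hε).1, ?_⟩
  intro P
  have hPβ : ∀ β, P β = ∑ ε ∈ s.filter live, ε β := fun β ↦ by
    change corrAction μ D.isSmoothProjective D.isSmoothProjective
      (rfl : 2 * (m + 1) + 2 * (2 * (m + 1)) = 2 * (m + 1) + 2 * (2 * (m + 1)))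
      (∑ ε ∈ s.filter live, γf ε) β = _
    rw [hP, LinearMap.sum_apply]
  refine ⟨fun β hβ ↦ ?_, fun β ↦ ?_, ?_⟩
  · -- rational classes are preserved: each block preserves them
    rw [hPβ]
    exact Finset.sum_induction _ (fun x ↦ IsRationalClass x) (fun a b ha hb ↦ ha.add hb)
      IsRationalClass.zero (fun ε hε ↦ (hblk ε (Finset.mem_filter.1 hε).1).2.2.2.1 β hβ)
  · -- the image is purely `(n,n)`: a sum of `(n,n)`-classes, tested in one Hodge model
    rw [hPβ]
    obtain ⟨A, -⟩ := hH
    refine (isOfHodgeType_iff_mem_hodgePQ D.isSmoothProjective A _).2 ?_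
    rw [map_sum]
    exact Submodule.sum_mem _ fun ε hε ↦
      (isOfHodgeType_iff_mem_hodgePQ D.isSmoothProjective A _).1 (hpure ε hε β)
  · -- `e` is fixed: `e = Σ_ε ε e` and the dead blocks kill `e` by definition
    rw [hPβ]
    have he_sum : e = ∑ ε ∈ s, ε e := by
      conv_lhs => rw [show e = (∑ ε ∈ s, ε) e by rw [hsum]; rfl]
      rw [LinearMap.sum_apply]
    have hzero : ∑ ε ∈ s.filter (fun ε ↦ ¬ live ε), ε e = 0 :=
      Finset.sum_eq_zero fun ε hε ↦ not_not.1 (Finset.mem_filter.1 hε).2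
    conv_rhs => rw [he_sum, ← Finset.sum_filter_add_sum_filter_not s live]
    rw [hzero, add_zero]

end Summit.HodgeConjecture.HodgeConjecture.Cruxes.OrthogonalEnveloped.HodgeTateLegibleEnvelope

end
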